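import Mathlib
import HarnessLib

/-!
# Ingham's smoothing method: the smoothed explicit formula and the oscillation theorem

Topic `Literature/NumberTheory/LFunctions` (trunk T-ANT). This file proves, sorry-free and in an
abstract form independent of `ζ`, the analytic engine of Ingham's 1942 method as presented by
Bateman–Diamond, *Analytic Number Theory: An Introductory Course*, Thm. 11.12 — generalised from
the Fejér kernel to an arbitrary non-negative band-limited kernel, which is the form stated by
Odlyzko–te Riele (J. reine angew. Math. 357 (1985), §2, Theorem p. 144) and used in their
disproof of the Mertens conjecture. It is the ingredient (A) of
`Literature/NumberTheory/LFunctions/MertensConjectureDisproof.lean`; the number-theoretic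
inputs (Landau's theorem for `M(x)`, the local structure of `1/((s+½)ζ(s+½))` at simple zeros) are
supplied elsewhere and enter here only through the hypothesis `SmoothingData.laplace_eq`.

We work in logarithmic variables `u = log x` throughout (Odlyzko–te Riele (2.5)–(2.6)):
`f(u)` plays the role of `m(u) = M(e^u)e^{-u/2}`, the smoothing is the additive convolution
`∫ K(y-u) f(u) du`, and the transform is `k(t) = ∫ K(y) e^{-ity} dy` ((2.9) of the source).

## Main results (all proved)

* `exists_large_almostPeriod`, `trigSum_frequently_near` — finite trigonometric sums are almost
  periodic (B–D Lemmas 11.1, 11.3), by compactness of the torus.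
* `eventually_average_le` — a mass-one non-negative kernel averages one-sided bounds (the last
  step of B–D Thm. 11.12).
* `kernel_eq_integral_transform`, `smooth_eq_integral_transform` — Fourier inversion for the
  kernel and the smoothing identity `∫ K(y-u) g(u) du = (2π)⁻¹ ∫ k(t) e^{ity} ĝ(t) dt` (Fubini).
* `SmoothingData` — the hypotheses of the smoothed explicit formula: `f ≤ A`, `f = 0` on
  `(-∞,0)`, `f(u)e^{-σu}` integrable for `σ > 0`, and on `0 < σ ≤ σ₀, |t| ≤ T'` the Laplace
  transform of `f` equals `Σ a_i/(s - iγ_i) + R(s)` with `R` continuous on the closed rectangle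
  `[0,σ₀] × [-T',T']`; `K ≥ 0` continuous integrable with `k = 0` off `(-T',T')`.
* `SmoothingData.smoothed_explicit_formula` — **(11.7) of Bateman–Diamond** for general kernels:
  `u ↦ K(y-u)f(u)` is integrable and `∫ K(y-u) f(u) du = Re Σ a_i k(γ_i) e^{iγ_i y} + o(1)`.
* `frequently_gt_and_lt_of_laplace` — **(11.8) of Bateman–Diamond / (2.17)–(2.18) of
  Odlyzko–te Riele**, abstract form: if every one-sided bound on `f` yields `SmoothingData`, then
  for all `y₀`, `ε > 0`: `f(y) > Re S(y₀) - ε` and `f(y) < Re S(y₀) + ε` for arbitrarily large `y`.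

## Proof architecture (and where it differs from the printed one)

Bateman–Diamond exchange integrations in `∫_{-T}^{T} (1-|t|/T) e^{ity} G(σ+it) dt`, evaluate the
polar integrals `∫ (1-|t|/T) e^{ity} (s-iγ)⁻¹ dt` by a contour shift, and let `σ → 0+`. We avoid the
contour shift (which needs the Lipschitz continuity of the Fejér weight) by moving the polar part
to the `u`-side: `a_i/(s-iγ_i)` is the Laplace transform of the mode `a_i e^{iγ_i u} 1_{u≥0}`
(`expMode`, `integral_expMode_mul_cexp`), so the smoothing identity is applied to the difference
`D_σ = f_σ - Σ a_i E_{γ_i,σ}` whose transform is the regular part `R(σ+it)` (`integral_diff_mul_cexp`,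
`smooth_diff_eq`). The limit `σ → 0+` is dominated convergence on the `t`-side (`R` is continuous
up to `σ = 0`: `tendsto_integral_R`) and on the modes (`tendsto_smooth_expMode`), and monotone
convergence for the non-negative part `q = max(A,0)1_{[0,∞)} - f` exactly as in the book
(`integrable_kernel_negPart`); the `y → ∞` behaviour is the Riemann–Lebesgue lemma for the
regular part (`tendsto_integral_R_atTop`) and the tail of the transform integral for the modes
(`tendsto_smooth_expMode_sub`). The oscillation theorem is then obtained by contradiction: the
negation of "`f(y) > Re S(y₀) - ε` frequently" is a one-sided bound, which feeds `SmoothingData`,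
and averaging the smoothed formula contradicts almost periodicity of `S`.

Two further departures from the printed Theorem 11.12, both visible in the Lean statements:
Bateman–Diamond assume the weaker one-sided bound `F(x) < log^β x` (some `β < 1`, `x` large) and
continuity of `G - G*` on the closed half-strip `{σ ≥ 0, |t| ≤ T}`; `SmoothingData` assumes a
*constant* bound `f ≤ A` (so the formal (11.7), `smoothed_explicit_formula`, is the special case
of the printed one in that hypothesis — the form produced by the contradiction argument, and the
natural one for merely integrable kernels, cf. Remarks 11.13) and continuity of the regular part
only on the closed rectangle `[0, σ₀] × [-T', T']`. The headline `frequently_gt_and_lt_of_laplace`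
has no bound hypothesis at all and is at least as strong as the printed (11.8).

## References

* [BatemanDiamond2004] P. T. Bateman, H. G. Diamond, Analytic Number Theory: An Introductory
  Course, World Scientific 2004: §11.2 Lemmas 11.1, 11.3; §11.5 Theorem 11.12, (11.7)–(11.10),
  Remarks 11.13.
* [OdlyzkoTeRiele1985] A. M. Odlyzko, H. J. J. te Riele, Disproof of the Mertens conjecture,
  J. reine angew. Math. 357 (1985), 138–160: §2, (2.9)–(2.18) and the Theorem on p. 144.
* [Ingham1942] A. E. Ingham, On two conjectures in the theory of numbers, Amer. J. Math. 64
  (1942), 313–319.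
-/

noncomputable section

open Complex Filter MeasureTheory Set Topology
open scoped Real FourierTransform

namespace Literature.NumberTheory.LFunctions
namespace InghamSmoothing


/-! ### Almost periodicity of finite trigonometric sums -/

/-- **Simultaneous recurrence** (the qualitative content of Dirichlet's simultaneous
approximation theorem, Bateman–Diamond Lemma 11.1): for finitely many real frequencies `γ_i`,
any `δ > 0` and any `L > 0` there is `τ ≥ L` with `|e^{iγ_i τ} - 1| < δ` for all `i`. Proof by
compactness of the torus: the sequence `n ↦ (e^{iγ_i nL})_i` has a convergent subsequence, and
the difference of two close terms is a large almost-period. [cite: BatemanDiamond2004, Lemma 11.1] -/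
theorem exists_large_almostPeriod {ι : Type*} (P : Finset ι) (γ : ι → ℝ) {δ L : ℝ}
    (hδ : 0 < δ) (hL : 0 < L) :
    ∃ τ : ℝ, L ≤ τ ∧ ∀ i ∈ P, ‖cexp (((γ i * τ : ℝ) : ℂ) * I) - 1‖ < δ := by
  set z : ℕ → (↥P → ℂ) := fun n i ↦ cexp (((γ i * (n * L) : ℝ) : ℂ) * I) with hz
  have hmem : ∀ n, z n ∈ Set.pi Set.univ (fun _ : ↥P ↦ Metric.closedBall (0 : ℂ) 1) := by
    intro n i _
    rw [Metric.mem_closedBall, dist_zero_right]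
    show ‖cexp (((γ i * (n * L) : ℝ) : ℂ) * I)‖ ≤ 1
    exact (Complex.norm_exp_ofReal_mul_I _).le
  have hcpt : IsCompact (Set.pi Set.univ (fun _ : ↥P ↦ Metric.closedBall (0 : ℂ) 1)) :=
    isCompact_univ_pi fun _ ↦ isCompact_closedBall 0 1
  obtain ⟨w, -, φ, hφ, hlim⟩ := hcpt.tendsto_subseq hmem
  obtain ⟨N, hN⟩ := (Metric.tendsto_atTop.1 hlim) (δ / 2) (by positivity)
  have hφlt : φ N < φ (N + 1) := hφ (Nat.lt_succ_self N)
  have h1 : (1 : ℝ) ≤ (φ (N + 1) : ℝ) - φ N := by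
    have : (φ N : ℝ) + 1 ≤ φ (N + 1) := by exact_mod_cast hφlt
    linarith
  refine ⟨((φ (N + 1) : ℝ) - φ N) * L, by nlinarith, fun i hi ↦ ?_⟩
  have hd : dist (z (φ (N + 1))) (z (φ N)) < δ := by
    calc dist (z (φ (N + 1))) (z (φ N)) ≤ dist (z (φ (N + 1))) w + dist (z (φ N)) w :=
          dist_triangle_right _ _ _
      _ < δ / 2 + δ / 2 := add_lt_add (hN _ (Nat.le_succ N)) (hN _ le_rfl)
      _ = δ := by ring
  have hcomp : dist (z (φ (N + 1)) ⟨i, hi⟩) (z (φ N) ⟨i, hi⟩) < δ :=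
    lt_of_le_of_lt (dist_le_pi_dist _ _ _) hd
  rw [dist_eq_norm] at hcomp
  have key : z (φ (N + 1)) ⟨i, hi⟩ - z (φ N) ⟨i, hi⟩ =
      z (φ N) ⟨i, hi⟩ * (cexp (((γ i * (((φ (N + 1) : ℝ) - φ N) * L) : ℝ) : ℂ) * I) - 1) := by
    simp only [hz]
    rw [mul_sub, mul_one, ← Complex.exp_add]
    congr 2
    push_cast
    ring
  rw [key, norm_mul] at hcomp
  have hz1 : ‖z (φ N) ⟨i, hi⟩‖ = 1 := by
    simp only [hz]
    exact Complex.norm_exp_ofReal_mul_I _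
  rwa [hz1, one_mul] at hcomp

/-- **Finite trigonometric sums are almost periodic** (Bateman–Diamond Lemma 11.3, the form
used at the end of the proof of Thm. 11.12): `S(y) = Σ c_i e^{iγ_i y}` returns within `ε` of
`S(y₀)` at arbitrarily large `y`. [cite: BatemanDiamond2004, Lemma 11.3] -/
theorem trigSum_frequently_near {ι : Type*} (P : Finset ι) (γ : ι → ℝ) (c : ι → ℂ) (y₀ : ℝ)
    {ε : ℝ} (hε : 0 < ε) :
    ∃ᶠ y in atTop, ‖∑ i ∈ P, c i * cexp (((γ i * y : ℝ) : ℂ) * I) -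
      ∑ i ∈ P, c i * cexp (((γ i * y₀ : ℝ) : ℂ) * I)‖ < ε := by
  rw [frequently_atTop]
  intro b
  set Cs : ℝ := ∑ i ∈ P, ‖c i‖ with hCs
  have hCs0 : 0 ≤ Cs := Finset.sum_nonneg fun i _ ↦ norm_nonneg _
  obtain ⟨τ, hτ, hclose⟩ := exists_large_almostPeriod P γ (δ := ε / (Cs + 1))
    (L := max (b - y₀) 1) (by positivity) (by positivity)
  refine ⟨y₀ + τ, by linarith [le_max_left (b - y₀) 1], ?_⟩
  have hrw : ∑ i ∈ P, c i * cexp (((γ i * (y₀ + τ) : ℝ) : ℂ) * I) -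
      ∑ i ∈ P, c i * cexp (((γ i * y₀ : ℝ) : ℂ) * I) =
      ∑ i ∈ P, c i * cexp (((γ i * y₀ : ℝ) : ℂ) * I) * (cexp (((γ i * τ : ℝ) : ℂ) * I) - 1) := by
    rw [← Finset.sum_sub_distrib]
    refine Finset.sum_congr rfl fun i _ ↦ ?_
    rw [mul_sub, mul_one, mul_assoc, ← Complex.exp_add]
    congr 3
    push_cast
    ring
  rw [hrw]
  calc ‖∑ i ∈ P, c i * cexp (((γ i * y₀ : ℝ) : ℂ) * I) * (cexp (((γ i * τ : ℝ) : ℂ) * I) - 1)‖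
      ≤ ∑ i ∈ P, ‖c i * cexp (((γ i * y₀ : ℝ) : ℂ) * I) * (cexp (((γ i * τ : ℝ) : ℂ) * I) - 1)‖ :=
        norm_sum_le _ _
    _ ≤ ∑ i ∈ P, ‖c i‖ * (ε / (Cs + 1)) := Finset.sum_le_sum fun i hi ↦ by
        rw [norm_mul, norm_mul, Complex.norm_exp_ofReal_mul_I, mul_one]
        exact mul_le_mul_of_nonneg_left (hclose i hi).le (norm_nonneg _)
    _ = Cs * (ε / (Cs + 1)) := by rw [← Finset.sum_mul]
    _ < ε := by
        rw [mul_div_assoc', div_lt_iff₀ (by positivity)]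
        nlinarith

/-- **Finite trigonometric sums have arbitrarily large `ε`-almost periods** (Bateman–Diamond
Lemma 11.3, the uniform statement: `|S(x + τ) - S(x)| < ε` for *all* `x`).
[cite: BatemanDiamond2004, Lemma 11.3] -/
theorem exists_large_epsAlmostPeriod {ι : Type*} (P : Finset ι) (γ : ι → ℝ) (c : ι → ℂ)
    {ε L : ℝ} (hε : 0 < ε) (hL : 0 < L) :
    ∃ τ : ℝ, L ≤ τ ∧ ∀ x : ℝ, ‖∑ i ∈ P, c i * cexp (((γ i * (x + τ) : ℝ) : ℂ) * I) -
      ∑ i ∈ P, c i * cexp (((γ i * x : ℝ) : ℂ) * I)‖ < ε := by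
  set Cs : ℝ := ∑ i ∈ P, ‖c i‖ with hCs
  have hCs0 : 0 ≤ Cs := Finset.sum_nonneg fun i _ ↦ norm_nonneg _
  obtain ⟨τ, hτ, hclose⟩ := exists_large_almostPeriod P γ (δ := ε / (Cs + 1)) (L := L)
    (by positivity) hL
  refine ⟨τ, hτ, fun x ↦ ?_⟩
  have hrw : ∑ i ∈ P, c i * cexp (((γ i * (x + τ) : ℝ) : ℂ) * I) -
      ∑ i ∈ P, c i * cexp (((γ i * x : ℝ) : ℂ) * I) =
      ∑ i ∈ P, c i * cexp (((γ i * x : ℝ) : ℂ) * I) * (cexp (((γ i * τ : ℝ) : ℂ) * I) - 1) := by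
    rw [← Finset.sum_sub_distrib]
    refine Finset.sum_congr rfl fun i _ ↦ ?_
    rw [mul_sub, mul_one, mul_assoc, ← Complex.exp_add]
    congr 3
    push_cast
    ring
  rw [hrw]
  calc ‖∑ i ∈ P, c i * cexp (((γ i * x : ℝ) : ℂ) * I) * (cexp (((γ i * τ : ℝ) : ℂ) * I) - 1)‖
      ≤ ∑ i ∈ P, ‖c i * cexp (((γ i * x : ℝ) : ℂ) * I) * (cexp (((γ i * τ : ℝ) : ℂ) * I) - 1)‖ :=
        norm_sum_le _ _
    _ ≤ ∑ i ∈ P, ‖c i‖ * (ε / (Cs + 1)) := Finset.sum_le_sum fun i hi ↦ by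
        rw [norm_mul, norm_mul, Complex.norm_exp_ofReal_mul_I, mul_one]
        exact mul_le_mul_of_nonneg_left (hclose i hi).le (norm_nonneg _)
    _ = Cs * (ε / (Cs + 1)) := by rw [← Finset.sum_mul]
    _ < ε := by
        rw [mul_div_assoc', div_lt_iff₀ (by positivity)]
        nlinarith

/-! ### Averaging against a non-negative kernel of mass one -/

/-- The mass of `K(y - ·)` to the left of `u₁` is the tail `∫_{v > y - u₁} K(v) dv`.
[folklore] -/
theorem integral_indicator_Iio_comp_sub (K : ℝ → ℝ) (y u₁ : ℝ) :
    ∫ u, (Set.Iio u₁).indicator (fun _ ↦ (1 : ℝ)) u * K (y - u) = ∫ v in Set.Ioi (y - u₁), K v := by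
  have h := integral_sub_left_eq_self (fun v ↦ (Set.Iio u₁).indicator (fun _ ↦ (1 : ℝ)) (y - v) * K v)
    volume y
  simp only [sub_sub_cancel] at h
  rw [h, ← integral_indicator measurableSet_Ioi]
  congr 1
  ext v
  by_cases hv : v ∈ Set.Ioi (y - u₁)
  · have : y - v ∈ Set.Iio u₁ := by simp only [Set.mem_Ioi] at hv; simp only [Set.mem_Iio]; linarith
    rw [Set.indicator_of_mem hv, Set.indicator_of_mem this, one_mul]
  · have : y - v ∉ Set.Iio u₁ := by simp only [Set.mem_Ioi, not_lt] at hv; simp only [Set.mem_Iio, not_lt]; linarith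
    rw [Set.indicator_of_notMem hv, Set.indicator_of_notMem this, zero_mul]

/-- Tails of an integrable function vanish: `∫_{v > y - u₁} K(v) dv → 0` as `y → ∞`. [folklore] -/
theorem tendsto_integral_Ioi_sub {K : ℝ → ℝ} (hK : Integrable K) (u₁ : ℝ) :
    Tendsto (fun y : ℝ ↦ ∫ v in Set.Ioi (y - u₁), K v) atTop (𝓝 0) := by
  have h := tendsto_setIntegral_of_antitone (μ := volume) (f := K) (s := fun y : ℝ ↦ Set.Ioi (y - u₁))
    (fun _ ↦ measurableSet_Ioi) (fun a b hab ↦ Set.Ioi_subset_Ioi (by linarith)) ⟨0, hK.integrableOn⟩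
  have he : ⋂ y : ℝ, Set.Ioi (y - u₁) = ∅ := by
    ext v
    simp only [Set.mem_iInter, Set.mem_Ioi, Set.mem_empty_iff_false, iff_false, not_forall, not_lt]
    exact ⟨v + u₁, by linarith⟩
  rwa [he, Measure.restrict_empty, integral_zero_measure] at h

/-- **Averaging** (the step "`F_T^*` is asymptotically an average of `F`" at the end of the proof
of Bateman–Diamond Thm. 11.12): if `K ≥ 0` has mass `1`, `f ≤ a` on `[u₁, ∞)` and `|f| ≤ B` on
`(-∞, u₁)`, then `∫ K(y-u) f(u) du ≤ a + ε` for all large `y`.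
[cite: BatemanDiamond2004, Theorem 11.12 (proof, (11.8))] -/
theorem eventually_average_le {K f : ℝ → ℝ} (hKnn : ∀ v, 0 ≤ K v)
    (hKi : Integrable K) (hK1 : ∫ v, K v = 1) {a B u₁ : ℝ}
    (hfa : ∀ u, u₁ ≤ u → f u ≤ a) (hfB : ∀ u, u < u₁ → |f u| ≤ B)
    (hfi : ∀ y, Integrable (fun u ↦ K (y - u) * f u)) {ε : ℝ} (hε : 0 < ε) :
    ∀ᶠ y in atTop, ∫ u, K (y - u) * f u ≤ a + ε := by
  have hB0 : 0 ≤ |B| := abs_nonneg B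
  -- the tail mass
  set tail : ℝ → ℝ := fun y ↦ ∫ v in Set.Ioi (y - u₁), K v with htail
  have htail0 : ∀ y, 0 ≤ tail y := fun y ↦ setIntegral_nonneg measurableSet_Ioi fun v _ ↦ hKnn v
  have hlim : Tendsto tail atTop (𝓝 0) := tendsto_integral_Ioi_sub hKi u₁
  have hev : ∀ᶠ y in atTop, (|B| + |a|) * tail y ≤ ε := by
    have h2 : Tendsto (fun y ↦ (|B| + |a|) * tail y) atTop (𝓝 0) := by
      simpa using hlim.const_mul (|B| + |a|)
    exact (h2.eventually (ge_mem_nhds hε)).mono fun y hy ↦ hy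
  filter_upwards [hev] with y hy
  -- translation invariance: `∫ K(y-u) du = 1`
  have hKyi : Integrable (fun u ↦ K (y - u)) := hKi.comp_sub_left y
  have hKy1 : ∫ u, K (y - u) = 1 := by rw [integral_sub_left_eq_self K volume y]; exact hK1
  -- split `f = 1_{(-∞,u₁)} f + 1_{[u₁,∞)} f`
  set χ : ℝ → ℝ := (Set.Iio u₁).indicator fun _ ↦ (1 : ℝ) with hχ
  have hχm : Measurable χ := (measurable_const.indicator measurableSet_Iio)
  have hχv : ∀ u, χ u = if u < u₁ then 1 else 0 := by
    intro u; simp only [hχ, Set.indicator_apply, Set.mem_Iio]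
  have hsplit : ∀ u, K (y - u) * f u =
      χ u * K (y - u) * f u + (1 - χ u) * K (y - u) * f u := by intro u; ring
  have hi1 : Integrable (fun u ↦ χ u * K (y - u) * f u) := by
    have : (fun u ↦ χ u * K (y - u) * f u) = fun u ↦ χ u * (K (y - u) * f u) := by
      funext u; ring
    rw [this]
    refine (hfi y).bdd_mul hχm.aestronglyMeasurable (c := 1) (ae_of_all _ fun u ↦ ?_)
    rw [hχv]; split_ifs <;> simp
  have hi2 : Integrable (fun u ↦ (1 - χ u) * K (y - u) * f u) := by
    have : (fun u ↦ (1 - χ u) * K (y - u) * f u) = fun u ↦ K (y - u) * f u - χ u * K (y - u) * f u := by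
      funext u; ring
    rw [this]
    exact (hfi y).sub hi1
  have hiχK : Integrable (fun u ↦ χ u * K (y - u)) :=
    hKyi.bdd_mul hχm.aestronglyMeasurable (c := 1)
      (ae_of_all _ fun u ↦ by rw [hχv]; split_ifs <;> simp)
  -- first piece: `≤ |B| · tail`
  have h1 : ∫ u, χ u * K (y - u) * f u ≤ |B| * tail y := by
    have hle : ∀ u, χ u * K (y - u) * f u ≤ |B| * (χ u * K (y - u)) := by
      intro u
      rw [hχv]
      split_ifs with hu
      · have hf := (abs_le.1 ((hfB u hu).trans (le_abs_self B)))
        have hK := hKnn (y - u)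
        nlinarith [hf.1, hf.2]
      · simp
    calc ∫ u, χ u * K (y - u) * f u ≤ ∫ u, |B| * (χ u * K (y - u)) :=
          integral_mono hi1 (hiχK.const_mul _) hle
      _ = |B| * tail y := by
          rw [integral_const_mul, htail]
          simp only [hχ]
          rw [integral_indicator_Iio_comp_sub K y u₁]
  -- second piece: `≤ a (1 - tail)`
  have h2 : ∫ u, (1 - χ u) * K (y - u) * f u ≤ a * (1 - tail y) := by
    have hle : ∀ u, (1 - χ u) * K (y - u) * f u ≤ a * ((1 - χ u) * K (y - u)) := by
      intro u
      rw [hχv]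
      split_ifs with hu
      · simp
      · have hf := hfa u (not_lt.1 hu)
        have hK := hKnn (y - u)
        nlinarith
    have hi3 : Integrable (fun u ↦ (1 - χ u) * K (y - u)) := by
      have : (fun u ↦ (1 - χ u) * K (y - u)) = fun u ↦ K (y - u) - χ u * K (y - u) := by
        funext u; ring
      rw [this]; exact hKyi.sub hiχK
    calc ∫ u, (1 - χ u) * K (y - u) * f u ≤ ∫ u, a * ((1 - χ u) * K (y - u)) :=
          integral_mono hi2 (hi3.const_mul _) hle
      _ = a * (1 - tail y) := by
          rw [integral_const_mul]
          congr 1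
          have : (fun u ↦ (1 - χ u) * K (y - u)) = fun u ↦ K (y - u) - χ u * K (y - u) := by
            funext u; ring
          rw [this, integral_sub hKyi hiχK, hKy1, htail]
          simp only [hχ]
          rw [integral_indicator_Iio_comp_sub K y u₁]
  calc ∫ u, K (y - u) * f u = ∫ u, (χ u * K (y - u) * f u + (1 - χ u) * K (y - u) * f u) := by
        congr 1; funext u; exact hsplit u
    _ = (∫ u, χ u * K (y - u) * f u) + ∫ u, (1 - χ u) * K (y - u) * f u := integral_add hi1 hi2
    _ ≤ |B| * tail y + a * (1 - tail y) := add_le_add h1 h2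
    _ = a + (|B| - a) * tail y := by ring
    _ ≤ a + (|B| + |a|) * tail y := by
        have := htail0 y
        nlinarith [neg_abs_le a]
    _ ≤ a + ε := by linarith


/-! ### The transform `k(t) = ∫ K(y) e^{-ity} dy`: continuity, Fourier inversion, smoothing identity -/

/-- `|e^{-ix}| = 1`. [folklore] -/
theorem norm_cexp_neg_ofReal_mul_I (x : ℝ) : ‖cexp (-(x : ℂ) * I)‖ = 1 := by
  rw [← Complex.ofReal_neg]; exact Complex.norm_exp_ofReal_mul_I _

variable {K : ℝ → ℝ} {k : ℝ → ℂ} {T' : ℝ}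

/-- `|k(t)| ≤ ∫ |K|`. [folklore] -/
theorem norm_transform_le (hk : ∀ t, k t = ∫ y, (K y : ℂ) * cexp (-((t * y : ℝ) : ℂ) * I))
    (t : ℝ) : ‖k t‖ ≤ ∫ y, |K y| := by
  rw [hk t]
  refine (norm_integral_le_integral_norm _).trans (le_of_eq ?_)
  congr 1
  ext y
  rw [norm_mul, norm_cexp_neg_ofReal_mul_I, mul_one, Complex.norm_real, Real.norm_eq_abs]

/-- The transform of an integrable kernel is continuous (dominated convergence). [folklore] -/
theorem continuous_transform (hKi : Integrable K)
    (hk : ∀ t, k t = ∫ y, (K y : ℂ) * cexp (-((t * y : ℝ) : ℂ) * I)) : Continuous k := by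
  have : k = fun t ↦ ∫ y, (K y : ℂ) * cexp (-((t * y : ℝ) : ℂ) * I) := funext hk
  rw [this]
  refine continuous_of_dominated (bound := fun y ↦ |K y|) ?_ ?_ hKi.abs ?_
  · intro t
    exact (Complex.continuous_ofReal.comp_aestronglyMeasurable hKi.1).mul
      (Continuous.aestronglyMeasurable (by fun_prop))
  · intro t
    refine ae_of_all _ fun y ↦ ?_
    rw [norm_mul, norm_cexp_neg_ofReal_mul_I, mul_one, Complex.norm_real, Real.norm_eq_abs]
  · refine ae_of_all _ fun y ↦ ?_
    fun_prop

/-- A transform vanishing for `|t| ≥ T'` is integrable. [folklore] -/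
theorem integrable_transform (hKi : Integrable K)
    (hk : ∀ t, k t = ∫ y, (K y : ℂ) * cexp (-((t * y : ℝ) : ℂ) * I))
    (hks : ∀ t, T' ≤ |t| → k t = 0) : Integrable k := by
  refine (continuous_transform hKi hk).integrable_of_hasCompactSupport ?_
  refine HasCompactSupport.intro (isCompact_Icc (a := -|T'|) (b := |T'|)) fun t ht ↦ hks t ?_
  simp only [Set.mem_Icc, not_and_or, not_le] at ht
  rcases ht with ht | ht
  · have h1 : |T'| < -t := by linarith
    have h2 : -t ≤ |t| := neg_le_abs t
    exact (le_abs_self _).trans (h1.trans_le h2).le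
  · have : |T'| < |t| := lt_of_lt_of_le ht (le_abs_self t)
    exact (le_abs_self _).trans this.le

/-- In Mathlib's normalisation, `𝓕 K (w) = k(2πw)`. [folklore] -/
theorem fourier_ofReal_eq (hk : ∀ t, k t = ∫ y, (K y : ℂ) * cexp (-((t * y : ℝ) : ℂ) * I))
    (w : ℝ) : 𝓕 (fun y ↦ (K y : ℂ)) w = k (2 * π * w) := by
  rw [hk, Real.fourier_real_eq_integral_exp_smul]
  congr 1
  ext y
  rw [smul_eq_mul, mul_comm]
  congr 2
  push_cast
  ring

/-- **Fourier inversion for the kernel**: `K(x) = (2π)⁻¹ ∫ k(t) e^{itx} dt` for a continuous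
integrable `K` whose transform vanishes off `[-T', T']` (Mathlib `Continuous.fourierInv_fourier_eq`).
[folklore] -/
theorem kernel_eq_integral_transform (hKc : Continuous K) (hKi : Integrable K)
    (hk : ∀ t, k t = ∫ y, (K y : ℂ) * cexp (-((t * y : ℝ) : ℂ) * I))
    (hks : ∀ t, T' ≤ |t| → k t = 0) (x : ℝ) :
    (K x : ℂ) = (((2 * π)⁻¹ : ℝ) : ℂ) * ∫ t, k t * cexp (((t * x : ℝ) : ℂ) * I) := by
  set Kc : ℝ → ℂ := fun y ↦ (K y : ℂ) with hKcdef
  have hKcc : Continuous Kc := Complex.continuous_ofReal.comp hKc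
  have hKci : Integrable Kc := hKi.ofReal
  have hF : 𝓕 Kc = fun w ↦ k (2 * π * w) := funext (fourier_ofReal_eq hk)
  have hkc := continuous_transform hKi hk
  have hFi : Integrable (𝓕 Kc) := by
    rw [hF]
    exact (integrable_transform hKi hk hks).comp_mul_left' (by positivity)
  have hinv := congr_fun (hKcc.fourierInv_fourier_eq hKci hFi) x
  have hinv' : (K x : ℂ) = 𝓕⁻ (𝓕 Kc) x := hinv.symm
  rw [hinv', Real.fourierInv_eq_fourier_neg, hF, Real.fourier_real_eq_integral_exp_smul]
  have hsub := Measure.integral_comp_mul_left (fun t ↦ k t * cexp (((t * x : ℝ) : ℂ) * I)) (2 * π)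
  calc ∫ v : ℝ, cexp (((-2 * π * v * -x : ℝ) : ℂ) * I) • k (2 * π * v)
      = ∫ v : ℝ, k (2 * π * v) * cexp ((((2 * π * v) * x : ℝ) : ℂ) * I) := by
        congr 1; ext v
        rw [smul_eq_mul, mul_comm]
        congr 3
        push_cast; ring
    _ = |(2 * π)⁻¹| • ∫ t, k t * cexp (((t * x : ℝ) : ℂ) * I) := hsub
    _ = (((2 * π)⁻¹ : ℝ) : ℂ) * ∫ t, k t * cexp (((t * x : ℝ) : ℂ) * I) := by
        rw [abs_of_pos (by positivity), ← Complex.real_smul]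

/-- A continuous integrable kernel with band-limited transform is bounded:
`|K(x)| ≤ (2π)⁻¹ ∫ |k|`. [folklore] -/
theorem abs_kernel_le (hKc : Continuous K) (hKi : Integrable K)
    (hk : ∀ t, k t = ∫ y, (K y : ℂ) * cexp (-((t * y : ℝ) : ℂ) * I))
    (hks : ∀ t, T' ≤ |t| → k t = 0) (x : ℝ) :
    |K x| ≤ (2 * π)⁻¹ * ∫ t, ‖k t‖ := by
  have h := kernel_eq_integral_transform hKc hKi hk hks x
  have : |K x| = ‖(K x : ℂ)‖ := by rw [Complex.norm_real, Real.norm_eq_abs]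
  rw [this, h, norm_mul, Complex.norm_real, Real.norm_eq_abs, abs_of_pos (by positivity)]
  refine mul_le_mul_of_nonneg_left ((norm_integral_le_integral_norm _).trans (le_of_eq ?_))
    (by positivity)
  congr 1; ext t
  rw [norm_mul, Complex.norm_exp_ofReal_mul_I, mul_one]

/-- **The smoothing identity** (Parseval/Fubini): for integrable `g`,
`∫ K(y-u) g(u) du = (2π)⁻¹ ∫ k(t) e^{ity} (∫ g(u) e^{-itu} du) dt`. This is the rigorous form of
Odlyzko–te Riele (2.10) / the exchange of integrations opening the proof of Bateman–Diamond
Thm. 11.12. [cite: BatemanDiamond2004, Theorem 11.12 (proof, (11.9))] -/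
theorem smooth_eq_integral_transform (hKc : Continuous K) (hKi : Integrable K)
    (hk : ∀ t, k t = ∫ y, (K y : ℂ) * cexp (-((t * y : ℝ) : ℂ) * I))
    (hks : ∀ t, T' ≤ |t| → k t = 0) {g : ℝ → ℂ} (hg : Integrable g) (y : ℝ) :
    ∫ u, (K (y - u) : ℂ) * g u = (((2 * π)⁻¹ : ℝ) : ℂ) *
      ∫ t, k t * cexp (((t * y : ℝ) : ℂ) * I) * ∫ u, g u * cexp (-((t * u : ℝ) : ℂ) * I) := by
  have hkc := continuous_transform hKi hk
  have hki := integrable_transform hKi hk hks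
  -- the double integrand
  set F : ℝ → ℝ → ℂ := fun u t ↦ k t * cexp (((t * (y - u) : ℝ) : ℂ) * I) * g u with hF
  have hFi : Integrable (Function.uncurry F) (volume.prod volume) := by
    refine Integrable.mono' (hg.norm.mul_prod hki.norm) ?_ (ae_of_all _ fun p ↦ ?_)
    · refine AEStronglyMeasurable.mul (AEStronglyMeasurable.mul ?_ ?_) hg.1.comp_fst
      · exact (hkc.comp continuous_snd).aestronglyMeasurable
      · exact Continuous.aestronglyMeasurable (by fun_prop)
    · rcases p with ⟨u, t⟩
      simp only [Function.uncurry_apply_pair, hF, norm_mul, Complex.norm_exp_ofReal_mul_I, mul_one]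
      rw [mul_comm]
  have hswap := integral_integral_swap hFi
  -- left side: `∫ K(y-u) g(u) du = (2π)⁻¹ ∫∫ F`
  have hL : ∀ u, (K (y - u) : ℂ) * g u = (((2 * π)⁻¹ : ℝ) : ℂ) * ∫ t, F u t := by
    intro u
    rw [kernel_eq_integral_transform hKc hKi hk hks (y - u), mul_assoc, ← integral_mul_const]
  simp_rw [hL]
  rw [integral_const_mul, hswap]
  congr 1
  refine integral_congr_ae (ae_of_all _ fun t ↦ ?_)
  simp only [hF]
  rw [← integral_const_mul]
  refine integral_congr_ae (ae_of_all _ fun u ↦ ?_)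
  dsimp only
  have : cexp (((t * (y - u) : ℝ) : ℂ) * I) =
      cexp (((t * y : ℝ) : ℂ) * I) * cexp (-((t * u : ℝ) : ℂ) * I) := by
    rw [← Complex.exp_add]; congr 1; push_cast; ring
  rw [this]; ring

/-! ### The model modes `e^{(iγ-σ)u} 1_{u ≥ 0}` -/

/-- `E_{γ,σ}(u) = e^{(-σ+iγ)u}` for `u ≥ 0` and `0` for `u < 0`: the function with Laplace
transform `1/(s - iγ)` (shifted by `σ`), the building block of Bateman–Diamond's `F*`.
[cite: BatemanDiamond2004, Theorem 11.12 (statement, `G*`)] -/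
def expMode (γ σ : ℝ) : ℝ → ℂ :=
  (Set.Ici (0 : ℝ)).indicator fun u ↦ cexp ((-(σ : ℂ) + (γ : ℂ) * I) * (u : ℂ))

/-- The mode on `[0, ∞)`. [folklore] -/
theorem expMode_of_nonneg {γ σ u : ℝ} (hu : 0 ≤ u) :
    expMode γ σ u = cexp ((-(σ : ℂ) + (γ : ℂ) * I) * (u : ℂ)) := by
  unfold expMode; rw [Set.indicator_of_mem (Set.mem_Ici.2 hu)]

/-- The mode vanishes on `(-∞, 0)`. [folklore] -/
theorem expMode_of_neg {γ σ u : ℝ} (hu : u < 0) : expMode γ σ u = 0 := by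
  unfold expMode; rw [Set.indicator_of_notMem (by simpa using hu)]

/-- `|E_{γ,σ}(u)| ≤ 1` for `σ ≥ 0`. [folklore] -/
theorem norm_expMode_le (γ : ℝ) {σ : ℝ} (hσ : 0 ≤ σ) (u : ℝ) : ‖expMode γ σ u‖ ≤ 1 := by
  rcases lt_or_ge u 0 with hu | hu
  · rw [expMode_of_neg hu, norm_zero]; exact zero_le_one
  · rw [expMode_of_nonneg hu, Complex.norm_exp]
    have : ((-(σ : ℂ) + (γ : ℂ) * I) * (u : ℂ)).re = -(σ * u) := by
      simp [Complex.mul_re]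
    rw [this, Real.exp_le_one_iff]
    nlinarith

/-- `E_{γ,σ}` is measurable. [folklore] -/
theorem aestronglyMeasurable_expMode (γ σ : ℝ) : AEStronglyMeasurable (expMode γ σ) := by
  unfold expMode
  exact (Continuous.aestronglyMeasurable (by fun_prop)).indicator measurableSet_Ici

/-- `E_{γ,σ}` is integrable for `σ > 0`. [folklore] -/
theorem integrable_expMode (γ : ℝ) {σ : ℝ} (hσ : 0 < σ) : Integrable (expMode γ σ) := by
  unfold expMode
  rw [integrable_indicator_iff measurableSet_Ici]
  rw [integrableOn_Ici_iff_integrableOn_Ioi]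
  refine integrableOn_exp_mul_complex_Ioi ?_ 0
  simpa using hσ

/-- The Fourier–Laplace transform of a mode: `∫_0^∞ e^{(-σ+iγ)u} e^{-itu} du = 1/(σ + it - iγ)`.
[cite: BatemanDiamond2004, Theorem 11.12 (statement, `G*(s) = Σ α_n (s - iγ_n)⁻¹`)] -/
theorem integral_expMode_mul_cexp (γ t : ℝ) {σ : ℝ} (hσ : 0 < σ) :
    ∫ u, expMode γ σ u * cexp (-((t * u : ℝ) : ℂ) * I) = 1 / ((σ : ℂ) + t * I - γ * I) := by
  have ha : (-(σ : ℂ) + (γ : ℂ) * I - t * I).re < 0 := by simpa using hσ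
  have heq : (fun u : ℝ ↦ expMode γ σ u * cexp (-((t * u : ℝ) : ℂ) * I)) =
      (Set.Ici (0 : ℝ)).indicator (fun u : ℝ ↦ cexp ((-(σ : ℂ) + (γ : ℂ) * I - t * I) * (u : ℂ))) := by
    ext u
    rcases lt_or_ge u 0 with hu | hu
    · rw [expMode_of_neg hu, zero_mul, Set.indicator_of_notMem (by simpa using hu)]
    · rw [expMode_of_nonneg hu, Set.indicator_of_mem (Set.mem_Ici.2 hu), ← Complex.exp_add]
      congr 1; push_cast; ring
  rw [heq, integral_indicator measurableSet_Ici, integral_Ici_eq_integral_Ioi,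
    integral_exp_mul_complex_Ioi ha 0]
  rw [Complex.ofReal_zero, mul_zero, Complex.exp_zero, neg_div, ← div_neg]
  congr 1
  ring

/-- Continuity of the modes in `σ` at `σ = 0⁺` under the smoothing: dominated convergence with
dominant `|K(y-u)|`. [folklore] -/
theorem tendsto_smooth_expMode {K : ℝ → ℝ} (hKc : Continuous K) (hKi : Integrable K) (γ y : ℝ) :
    Tendsto (fun σ : ℝ ↦ ∫ u, (K (y - u) : ℂ) * expMode γ σ u) (𝓝[>] 0)
      (𝓝 (∫ u, (K (y - u) : ℂ) * expMode γ 0 u)) := by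
  refine tendsto_integral_filter_of_dominated_convergence (bound := fun u ↦ |K (y - u)|) ?_ ?_
    ((hKi.comp_sub_left y).abs) ?_
  · exact Eventually.of_forall fun σ ↦
      (Complex.continuous_ofReal.comp (hKc.comp (continuous_sub_left y))).aestronglyMeasurable.mul
        (aestronglyMeasurable_expMode γ σ)
  · filter_upwards [self_mem_nhdsWithin] with σ hσ
    refine ae_of_all _ fun u ↦ ?_
    rw [norm_mul, Complex.norm_real, Real.norm_eq_abs]
    exact mul_le_of_le_one_right (abs_nonneg _) (norm_expMode_le γ (le_of_lt hσ) u)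
  · refine ae_of_all _ fun u ↦ ?_
    refine Tendsto.mono_left ?_ nhdsWithin_le_nhds
    refine (tendsto_const_nhds.mul ?_)
    rcases lt_or_ge u 0 with hu | hu
    · simp_rw [expMode_of_neg hu]; exact tendsto_const_nhds
    · simp_rw [expMode_of_nonneg hu]
      exact ((by fun_prop : Continuous fun σ : ℝ ↦ cexp ((-(σ : ℂ) + (γ : ℂ) * I) * (u : ℂ))).tendsto' 0 _
        (by simp))

/-- The smoothed mode at `σ = 0` is `e^{iγy}` times a partial transform:
`∫ K(y-u) E_{γ,0}(u) du = e^{iγy} ∫_{v ≤ y} K(v) e^{-iγv} dv`. [folklore] -/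
theorem smooth_expMode_zero (K : ℝ → ℝ) (γ y : ℝ) :
    ∫ u, (K (y - u) : ℂ) * expMode γ 0 u =
      cexp (((γ * y : ℝ) : ℂ) * I) * ∫ v in Set.Iic y, (K v : ℂ) * cexp (-((γ * v : ℝ) : ℂ) * I) := by
  have h := integral_sub_left_eq_self (fun v ↦ (K v : ℂ) * expMode γ 0 (y - v)) volume y
  simp only [sub_sub_cancel] at h
  rw [h, ← integral_indicator measurableSet_Iic, ← integral_const_mul]
  congr 1
  ext v
  by_cases hv : v ∈ Set.Iic y
  · have hv' : 0 ≤ y - v := by simp only [Set.mem_Iic] at hv; linarith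
    rw [Set.indicator_of_mem hv, expMode_of_nonneg hv', mul_left_comm, ← Complex.exp_add]
    congr 2; push_cast; ring
  · have hv' : y - v < 0 := by simp only [Set.mem_Iic, not_le] at hv; linarith
    rw [Set.indicator_of_notMem hv, expMode_of_neg hv', mul_zero, mul_zero]

/-- As `y → ∞`, `∫ K(y-u) E_{γ,0}(u) du - k(γ) e^{iγy} → 0` (the tail of the transform
integral). [folklore] -/
theorem tendsto_smooth_expMode_sub {K : ℝ → ℝ} {k : ℝ → ℂ} (hKi : Integrable K)
    (hk : ∀ t, k t = ∫ y, (K y : ℂ) * cexp (-((t * y : ℝ) : ℂ) * I)) (γ : ℝ) :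
    Tendsto (fun y : ℝ ↦ (∫ u, (K (y - u) : ℂ) * expMode γ 0 u) - k γ * cexp (((γ * y : ℝ) : ℂ) * I))
      atTop (𝓝 0) := by
  set H : ℝ → ℂ := fun v ↦ (K v : ℂ) * cexp (-((γ * v : ℝ) : ℂ) * I) with hH
  have hHi : Integrable H := by
    refine hKi.ofReal.mul_bdd (Continuous.aestronglyMeasurable (by fun_prop)) (c := 1)
      (ae_of_all _ fun v ↦ ?_)
    exact (norm_cexp_neg_ofReal_mul_I _).le
  have hlim : Tendsto (fun y : ℝ ↦ ∫ v in Set.Iic y, H v) atTop (𝓝 (k γ)) := by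
    have h := tendsto_setIntegral_of_monotone (μ := volume) (f := H) (s := fun y : ℝ ↦ Set.Iic y)
      (fun _ ↦ measurableSet_Iic) (fun a b hab ↦ Set.Iic_subset_Iic.2 hab)
      (by rw [Set.iUnion_Iic]; exact hHi.integrableOn)
    have hHk : ∫ x, H x = k γ := (hk γ).symm
    rw [Set.iUnion_Iic, Measure.restrict_univ, hHk] at h
    exact h
  rw [tendsto_zero_iff_norm_tendsto_zero]
  have hnorm : ∀ y : ℝ,
      ‖(∫ u, (K (y - u) : ℂ) * expMode γ 0 u) - k γ * cexp (((γ * y : ℝ) : ℂ) * I)‖ =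
      ‖(∫ v in Set.Iic y, H v) - k γ‖ := by
    intro y
    rw [smooth_expMode_zero, mul_comm (k γ), ← mul_sub, norm_mul, Complex.norm_exp_ofReal_mul_I,
      one_mul]
  simp_rw [hnorm]
  rw [← tendsto_zero_iff_norm_tendsto_zero]
  simpa using hlim.sub_const (k γ)

/-! ### The smoothed explicit formula (the core of Ingham's method) -/

/-- **Hypotheses of the smoothed explicit formula** (Bateman–Diamond Thm. 11.12, generalised from
the Fejér kernel to an arbitrary band-limited non-negative kernel, in the variables `u = log x`):
a real function `f`, vanishing on `(-∞, 0)`, measurable, bounded above by `A`, whose damped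
versions `f(u)e^{-σu}` (`σ > 0`) are integrable, and whose Laplace transform on the half-strip
`0 < σ ≤ σ₀, |t| ≤ T'` is a finite sum of simple polar parts `a_i/(s - iγ_i)` plus a function `R`
continuous on the *closed* rectangle `[0, σ₀] × [-T', T']`; and a continuous, non-negative,
integrable kernel `K` whose transform `k(t) = ∫ K(y)e^{-ity} dy` vanishes for `|t| ≥ T'`.
[cite: BatemanDiamond2004, Theorem 11.12 (hypotheses)] -/
structure SmoothingData {ι : Type*} (P : Finset ι) (γ : ι → ℝ) (a : ι → ℂ) (f K : ℝ → ℝ)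
    (k : ℝ → ℂ) (R : ℂ → ℂ) (A σ₀ T' : ℝ) : Prop where
  f_meas : Measurable f
  f_neg : ∀ u, u < 0 → f u = 0
  f_le : ∀ u, f u ≤ A
  f_int : ∀ σ, 0 < σ → Integrable (fun u ↦ f u * Real.exp (-(σ * u)))
  K_cont : Continuous K
  K_nonneg : ∀ v, 0 ≤ K v
  K_int : Integrable K
  k_eq : ∀ t, k t = ∫ y, (K y : ℂ) * cexp (-((t * y : ℝ) : ℂ) * I)
  k_zero : ∀ t, T' ≤ |t| → k t = 0
  σ₀_pos : 0 < σ₀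
  R_cont : ContinuousOn R (Set.Icc 0 σ₀ ×ℂ Set.Icc (-T') T')
  laplace_eq : ∀ σ t : ℝ, 0 < σ → σ ≤ σ₀ → |t| ≤ T' →
    ∫ u, (f u : ℂ) * cexp (-(((σ : ℂ) + t * I) * u)) =
      ∑ i ∈ P, a i / ((σ : ℂ) + t * I - γ i * I) + R (σ + t * I)

/-- The rectangle `[0, σ₀] × [-T', T']` is compact. [folklore] -/
theorem isCompact_rect (σ₀ T' : ℝ) : IsCompact (Set.Icc (0 : ℝ) σ₀ ×ℂ Set.Icc (-T') T') :=
  isCompact_Icc.reProdIm isCompact_Icc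

/-- Membership in the rectangle. [folklore] -/
theorem add_mul_I_mem_rect {σ₀ T' σ t : ℝ} (h0 : 0 ≤ σ) (h1 : σ ≤ σ₀) (ht : |t| ≤ T') :
    (σ : ℂ) + t * I ∈ Set.Icc (0 : ℝ) σ₀ ×ℂ Set.Icc (-T') T' := by
  rw [Complex.mem_reProdIm]
  have := abs_le.1 ht
  constructor
  · simp only [Complex.add_re, Complex.ofReal_re, Complex.mul_re, Complex.I_re, mul_zero,
      Complex.ofReal_im, Complex.I_im, mul_one, sub_self, add_zero, Set.mem_Icc]
    exact ⟨h0, h1⟩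
  · simp only [Complex.add_im, Complex.ofReal_im, Complex.mul_im, Complex.ofReal_re, Complex.I_im,
      mul_one, Complex.I_re, mul_zero, add_zero, zero_add, Set.mem_Icc]
    exact ⟨this.1, this.2⟩

namespace SmoothingData

variable {ι : Type*} {P : Finset ι} {γ : ι → ℝ} {a : ι → ℂ} {f K : ℝ → ℝ} {k : ℝ → ℂ}
  {R : ℂ → ℂ} {A σ₀ T' : ℝ} (h : SmoothingData P γ a f K k R A σ₀ T')
include h

/-- The damped function `f_σ(u) = f(u) e^{-σu}` as a complex function is integrable. [folklore] -/
theorem integrable_damped {σ : ℝ} (hσ : 0 < σ) :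
    Integrable (fun u ↦ (((f u * Real.exp (-(σ * u)) : ℝ)) : ℂ)) := (h.f_int σ hσ).ofReal

omit h in
/-- `f(u) e^{-(σ+it)u} = f_σ(u) e^{-itu}`. [folklore] -/
theorem damped_mul_cexp (f : ℝ → ℝ) (σ t u : ℝ) :
    (f u : ℂ) * cexp (-(((σ : ℂ) + t * I) * u)) =
      (((f u * Real.exp (-(σ * u)) : ℝ)) : ℂ) * cexp (-((t * u : ℝ) : ℂ) * I) := by
  push_cast
  rw [mul_assoc, ← Complex.exp_add]
  congr 2; ring

/-- The difference `D_σ = f_σ - Σ a_i E_{γ_i,σ}` (Bateman–Diamond's `F - F*`, damped).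
[cite: BatemanDiamond2004, Theorem 11.12 (proof)] -/
def diff (_h : SmoothingData P γ a f K k R A σ₀ T') (σ : ℝ) (u : ℝ) : ℂ :=
  (((f u * Real.exp (-(σ * u)) : ℝ)) : ℂ) - ∑ i ∈ P, a i * expMode (γ i) σ u

/-- Unfolding `D_σ`. [folklore] -/
theorem diff_apply (σ u : ℝ) : h.diff σ u =
    (((f u * Real.exp (-(σ * u)) : ℝ)) : ℂ) - ∑ i ∈ P, a i * expMode (γ i) σ u := rfl

/-- `D_σ` is integrable for `σ > 0`. [folklore] -/
theorem integrable_diff {σ : ℝ} (hσ : 0 < σ) : Integrable (h.diff σ) :=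
  (h.integrable_damped hσ).sub (integrable_finsetSum _ fun _ _ ↦ (integrable_expMode _ hσ).const_mul _)

/-- The transform of `D_σ` on `|t| ≤ T'` is the regular part `R(σ + it)`: the polar parts cancel.
[cite: BatemanDiamond2004, Theorem 11.12 (proof, (11.9))] -/
theorem integral_diff_mul_cexp {σ t : ℝ} (hσ : 0 < σ) (hσ' : σ ≤ σ₀) (ht : |t| ≤ T') :
    ∫ u, h.diff σ u * cexp (-((t * u : ℝ) : ℂ) * I) = R (σ + t * I) := by
  have h1 : ∫ u, (((f u * Real.exp (-(σ * u)) : ℝ)) : ℂ) * cexp (-((t * u : ℝ) : ℂ) * I) =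
      ∑ i ∈ P, a i / ((σ : ℂ) + t * I - γ i * I) + R (σ + t * I) := by
    rw [← h.laplace_eq σ t hσ hσ' ht]
    exact integral_congr_ae (ae_of_all _ fun u ↦ (damped_mul_cexp f σ t u).symm)
  have hEi : ∀ i ∈ P, Integrable fun u ↦ a i * expMode (γ i) σ u * cexp (-((t * u : ℝ) : ℂ) * I) := by
    intro i _
    refine ((integrable_expMode _ hσ).const_mul (a i)).mul_bdd
      (Continuous.aestronglyMeasurable (by fun_prop)) (c := 1) (ae_of_all _ fun u ↦ ?_)
    exact (norm_cexp_neg_ofReal_mul_I _).le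
  have hfi : Integrable fun u ↦
      (((f u * Real.exp (-(σ * u)) : ℝ)) : ℂ) * cexp (-((t * u : ℝ) : ℂ) * I) := by
    refine (h.integrable_damped hσ).mul_bdd (Continuous.aestronglyMeasurable (by fun_prop)) (c := 1)
      (ae_of_all _ fun u ↦ ?_)
    exact (norm_cexp_neg_ofReal_mul_I _).le
  have h2 : ∀ u, h.diff σ u * cexp (-((t * u : ℝ) : ℂ) * I) =
      (((f u * Real.exp (-(σ * u)) : ℝ)) : ℂ) * cexp (-((t * u : ℝ) : ℂ) * I) -
        ∑ i ∈ P, a i * expMode (γ i) σ u * cexp (-((t * u : ℝ) : ℂ) * I) := by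
    intro u; rw [diff_apply, sub_mul, Finset.sum_mul]
  simp_rw [h2]
  rw [integral_sub hfi (integrable_finsetSum _ hEi), integral_finsetSum _ hEi, h1]
  have h3 : ∀ i ∈ P, ∫ u, a i * expMode (γ i) σ u * cexp (-((t * u : ℝ) : ℂ) * I) =
      a i / ((σ : ℂ) + t * I - γ i * I) := by
    intro i _
    simp_rw [mul_assoc]
    rw [integral_const_mul, integral_expMode_mul_cexp _ _ hσ]
    ring
  rw [Finset.sum_congr rfl h3]
  ring

/-- **The smoothed difference is a band-limited integral of the regular part**:
`∫ K(y-u) D_σ(u) du = (2π)⁻¹ ∫ k(t) e^{ity} R(σ+it) dt` for `0 < σ ≤ σ₀`.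
[cite: BatemanDiamond2004, Theorem 11.12 (proof, (11.9)–(11.10))] -/
theorem smooth_diff_eq {σ : ℝ} (hσ : 0 < σ) (hσ' : σ ≤ σ₀) (y : ℝ) :
    ∫ u, (K (y - u) : ℂ) * h.diff σ u =
      (((2 * π)⁻¹ : ℝ) : ℂ) * ∫ t, k t * cexp (((t * y : ℝ) : ℂ) * I) * R (σ + t * I) := by
  rw [smooth_eq_integral_transform h.K_cont h.K_int h.k_eq h.k_zero (h.integrable_diff hσ) y]
  congr 1
  refine integral_congr_ae (ae_of_all _ fun t ↦ ?_)
  dsimp only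
  by_cases ht : |t| ≤ T'
  · rw [h.integral_diff_mul_cexp hσ hσ' ht]
  · rw [h.k_zero t (le_of_not_ge ht), zero_mul, zero_mul, zero_mul]

/-- A bound for `R` on the rectangle. [folklore] -/
theorem exists_bound_R :
    ∃ M : ℝ, 0 ≤ M ∧ ∀ s ∈ Set.Icc (0 : ℝ) σ₀ ×ℂ Set.Icc (-T') T', ‖R s‖ ≤ M := by
  obtain ⟨M, hM⟩ := (isCompact_rect σ₀ T').exists_bound_of_continuousOn h.R_cont
  exact ⟨max M 0, le_max_right _ _, fun s hs ↦ (hM s hs).trans (le_max_left _ _)⟩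

/-- Off `[-T', T']` we have `k = 0`. [folklore] -/
theorem k_zero_of_not_mem {t : ℝ} (ht : t ∉ Set.Icc (-T') T') : k t = 0 := by
  refine h.k_zero t ?_
  simp only [Set.mem_Icc, not_and_or, not_le] at ht
  rcases ht with ht | ht
  · have : -t ≤ |t| := neg_le_abs t
    linarith
  · exact ht.le.trans (le_abs_self t)

/-- For `σ ∈ [0, σ₀]`, the band-limited integrand `t ↦ k(t) e^{ity} R(σ + it)` is
a.e.-strongly measurable (it is continuous on `[-T', T']` and vanishes outside). [folklore] -/
theorem aestronglyMeasurable_integrand {σ : ℝ} (hσ : 0 ≤ σ) (hσ' : σ ≤ σ₀) (y : ℝ) :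
    AEStronglyMeasurable (fun t : ℝ ↦ k t * cexp (((t * y : ℝ) : ℂ) * I) * R (σ + t * I)) := by
  have hkc := continuous_transform h.K_int h.k_eq
  have hcont : ContinuousOn (fun t : ℝ ↦ k t * cexp (((t * y : ℝ) : ℂ) * I) * R (σ + t * I))
      (Set.Icc (-T') T') := by
    refine (hkc.continuousOn.mul (Continuous.continuousOn (by fun_prop))).mul ?_
    refine h.R_cont.comp (Continuous.continuousOn (by fun_prop)) fun t ht ↦ ?_
    exact add_mul_I_mem_rect hσ hσ' (abs_le.2 ⟨by linarith [ht.1], ht.2⟩)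
  have heq : (fun t : ℝ ↦ k t * cexp (((t * y : ℝ) : ℂ) * I) * R (σ + t * I)) =
      (Set.Icc (-T') T').indicator
        (fun t : ℝ ↦ k t * cexp (((t * y : ℝ) : ℂ) * I) * R (σ + t * I)) := by
    ext t
    by_cases ht : t ∈ Set.Icc (-T') T'
    · rw [Set.indicator_of_mem ht]
    · rw [Set.indicator_of_notMem ht, h.k_zero_of_not_mem ht, zero_mul, zero_mul]
  rw [heq, aestronglyMeasurable_indicator_iff measurableSet_Icc]
  exact hcont.aestronglyMeasurable measurableSet_Icc

/-- Domination: `|k(t) e^{ity} R(σ+it)| ≤ |k(t)| M`. [folklore] -/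
theorem norm_integrand_le {M : ℝ} (hM : ∀ s ∈ Set.Icc (0 : ℝ) σ₀ ×ℂ Set.Icc (-T') T', ‖R s‖ ≤ M)
    {σ : ℝ} (hσ : 0 ≤ σ) (hσ' : σ ≤ σ₀) (y t : ℝ) :
    ‖k t * cexp (((t * y : ℝ) : ℂ) * I) * R (σ + t * I)‖ ≤ ‖k t‖ * M := by
  by_cases ht : |t| ≤ T'
  · rw [norm_mul, norm_mul, Complex.norm_exp_ofReal_mul_I, mul_one]
    exact mul_le_mul_of_nonneg_left (hM _ (add_mul_I_mem_rect hσ hσ' ht)) (norm_nonneg _)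
  · rw [h.k_zero t (le_of_not_ge ht)]
    simp

/-- **The limit `σ → 0⁺` of the band-limited side** exists by dominated convergence, since `R`
is continuous up to the boundary segment `σ = 0`.
[cite: BatemanDiamond2004, Theorem 11.12 (proof, limit `σ → 0+` in (11.10))] -/
theorem tendsto_integral_R (y : ℝ) :
    Tendsto (fun σ : ℝ ↦ ∫ t, k t * cexp (((t * y : ℝ) : ℂ) * I) * R (σ + t * I)) (𝓝[>] 0)
      (𝓝 (∫ t, k t * cexp (((t * y : ℝ) : ℂ) * I) * R (t * I))) := by
  obtain ⟨M, hM0, hM⟩ := h.exists_bound_R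
  have hki := integrable_transform h.K_int h.k_eq h.k_zero
  have hev : ∀ᶠ σ : ℝ in 𝓝[>] 0, 0 < σ ∧ σ ≤ σ₀ := by
    filter_upwards [Ioo_mem_nhdsGT h.σ₀_pos] with σ hσ using ⟨hσ.1, hσ.2.le⟩
  have hlim0 : (∫ t, k t * cexp (((t * y : ℝ) : ℂ) * I) * R (t * I)) =
      ∫ t, k t * cexp (((t * y : ℝ) : ℂ) * I) * R (((0 : ℝ) : ℂ) + t * I) := by simp
  rw [hlim0]
  refine tendsto_integral_filter_of_dominated_convergence (bound := fun t ↦ ‖k t‖ * M) ?_ ?_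
    (hki.norm.mul_const M) ?_
  · filter_upwards [hev] with σ hσ using h.aestronglyMeasurable_integrand hσ.1.le hσ.2 y
  · filter_upwards [hev] with σ hσ
    exact ae_of_all _ fun t ↦ h.norm_integrand_le hM hσ.1.le hσ.2 y t
  · refine ae_of_all _ fun t ↦ ?_
    by_cases ht : |t| ≤ T'
    · refine (tendsto_const_nhds.mul ?_)
      have hmem : ((0 : ℝ) : ℂ) + t * I ∈ Set.Icc (0 : ℝ) σ₀ ×ℂ Set.Icc (-T') T' :=
        add_mul_I_mem_rect le_rfl h.σ₀_pos.le ht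
      have hc := h.R_cont _ hmem
      refine hc.tendsto.comp ?_
      rw [tendsto_nhdsWithin_iff]
      constructor
      · exact ((by fun_prop : Continuous fun σ : ℝ ↦ (σ : ℂ) + t * I).tendsto 0).mono_left
          nhdsWithin_le_nhds
      · filter_upwards [hev] with σ hσ using add_mul_I_mem_rect hσ.1.le hσ.2 ht
    · have hk0 := h.k_zero t (le_of_not_ge ht)
      simp_rw [hk0, zero_mul]
      exact tendsto_const_nhds

omit h in
/-- **Riemann–Lebesgue for the regular part**: `∫ k(t) e^{ity} R(it) dt → 0` as `y → ∞`.
(Stated for arbitrary `k`, `R`: by Mathlib's `Real.zero_at_infty_fourier` and the Bochner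
convention `∫ = 0` for non-integrable integrands the statement is unconditional; it is *used* only
for the integrable band-limited integrand of `smoothed_explicit_formula`.)
[cite: BatemanDiamond2004, Theorem 11.12 (proof, "H(y) → 0 by the Riemann–Lebesgue lemma")] -/
theorem tendsto_integral_R_atTop (k : ℝ → ℂ) (R : ℂ → ℂ) :
    Tendsto (fun y : ℝ ↦ ∫ t, k t * cexp (((t * y : ℝ) : ℂ) * I) * R (t * I)) atTop (𝓝 0) := by
  set φ : ℝ → ℂ := fun t ↦ k t * R (t * I) with hφ
  have heq : ∀ y : ℝ, (∫ t, k t * cexp (((t * y : ℝ) : ℂ) * I) * R (t * I)) =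
      𝓕 φ (-(y / (2 * π))) := by
    intro y
    rw [Real.fourier_real_eq_integral_exp_smul]
    refine integral_congr_ae (ae_of_all _ fun t ↦ ?_)
    simp only [hφ, smul_eq_mul]
    have : cexp (((-2 * π * t * -(y / (2 * π)) : ℝ) : ℂ) * I) = cexp (((t * y : ℝ) : ℂ) * I) := by
      congr 3; field_simp
    rw [this]; ring
  simp_rw [heq]
  refine (Real.zero_at_infty_fourier φ).comp ?_
  refine Tendsto.mono_right ?_ atBot_le_cocompact
  exact tendsto_neg_atTop_atBot.comp (tendsto_id.atTop_div_const (by positivity))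

end SmoothingData
namespace SmoothingData

variable {ι : Type*} {P : Finset ι} {γ : ι → ℝ} {a : ι → ℂ} {f K : ℝ → ℝ} {k : ℝ → ℂ}
  {R : ℂ → ℂ} {A σ₀ T' : ℝ} (h : SmoothingData P γ a f K k R A σ₀ T')
include h

/-- A uniform bound for the kernel. [folklore] -/
theorem exists_kernel_bound : ∃ C : ℝ, ∀ x, |K x| ≤ C :=
  ⟨_, fun x ↦ abs_kernel_le h.K_cont h.K_int h.k_eq h.k_zero x⟩

/-- `K(y - ·) g` is integrable for integrable complex `g`. [folklore] -/
theorem integrable_kernel_mul {g : ℝ → ℂ} (hg : Integrable g) (y : ℝ) :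
    Integrable (fun u ↦ (K (y - u) : ℂ) * g u) := by
  obtain ⟨C, hC⟩ := h.exists_kernel_bound
  refine hg.bdd_mul (Complex.continuous_ofReal.comp (h.K_cont.comp (continuous_sub_left y))
    |>.aestronglyMeasurable) (c := C) (ae_of_all _ fun u ↦ ?_)
  rw [Complex.norm_real, Real.norm_eq_abs]; exact hC _

/-- `K(y - ·) g` is integrable for integrable real `g`. [folklore] -/
theorem integrable_kernel_mul_real {g : ℝ → ℝ} (hg : Integrable g) (y : ℝ) :
    Integrable (fun u ↦ K (y - u) * g u) := by
  obtain ⟨C, hC⟩ := h.exists_kernel_bound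
  refine hg.bdd_mul ((h.K_cont.comp (continuous_sub_left y)).aestronglyMeasurable) (c := C)
    (ae_of_all _ fun u ↦ ?_)
  rw [Real.norm_eq_abs]; exact hC _

/-- The non-negative part `q = max(A,0)·1_{[0,∞)} - f ≥ 0` (Bateman–Diamond's `F⁻`-type
decomposition `F = F⁺ - F⁻` adapted to the one-sided bound).
[cite: BatemanDiamond2004, Theorem 11.12 (proof, "set F = F⁺ - F⁻")] -/
def negPart (_h : SmoothingData P γ a f K k R A σ₀ T') (u : ℝ) : ℝ :=
  max A 0 * (Set.Ici (0 : ℝ)).indicator (fun _ ↦ (1 : ℝ)) u - f u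

/-- Unfolding `q`. [folklore] -/
theorem negPart_apply (u : ℝ) :
    h.negPart u = max A 0 * (Set.Ici (0 : ℝ)).indicator (fun _ ↦ (1 : ℝ)) u - f u := rfl

/-- `q ≥ 0` (from `f ≤ A` and `f = 0` on `(-∞,0)`). [folklore] -/
theorem negPart_nonneg (u : ℝ) : 0 ≤ h.negPart u := by
  rw [negPart_apply]
  rcases lt_or_ge u 0 with hu | hu
  · rw [Set.indicator_of_notMem (by simpa using hu), h.f_neg u hu]; simp
  · rw [Set.indicator_of_mem (Set.mem_Ici.2 hu), mul_one, sub_nonneg]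
    exact (h.f_le u).trans (le_max_left _ _)

/-- `q = 0` on `(-∞, 0)`. [folklore] -/
theorem negPart_of_neg {u : ℝ} (hu : u < 0) : h.negPart u = 0 := by
  rw [negPart_apply, Set.indicator_of_notMem (by simpa using hu), h.f_neg u hu]; simp

/-- `q` is measurable. [folklore] -/
theorem measurable_negPart : Measurable h.negPart := by
  unfold negPart
  exact (measurable_const.mul (measurable_const.indicator measurableSet_Ici)).sub h.f_meas

omit h in
/-- The damped indicator `1_{[0,∞)}(u) e^{-σu}` is integrable for `σ > 0`. [folklore] -/
theorem integrable_indicator_damped {σ : ℝ} (hσ : 0 < σ) :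
    Integrable (fun u : ℝ ↦ (Set.Ici (0 : ℝ)).indicator (fun _ ↦ (1 : ℝ)) u * Real.exp (-(σ * u))) := by
  have : (fun u : ℝ ↦ (Set.Ici (0 : ℝ)).indicator (fun _ ↦ (1 : ℝ)) u * Real.exp (-(σ * u))) =
      (Set.Ici (0 : ℝ)).indicator (fun u : ℝ ↦ Real.exp ((-σ) * u)) := by
    ext u
    by_cases hu : u ∈ Set.Ici (0 : ℝ)
    · rw [Set.indicator_of_mem hu, Set.indicator_of_mem hu, one_mul, neg_mul]
    · rw [Set.indicator_of_notMem hu, Set.indicator_of_notMem hu, zero_mul]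
  rw [this, integrable_indicator_iff measurableSet_Ici, integrableOn_Ici_iff_integrableOn_Ioi]
  exact integrableOn_exp_mul_Ioi (by linarith) 0

omit h in
/-- The damped indicator as a mode: `1_{[0,∞)}(u) e^{-σu} = E_{0,σ}(u)`. [folklore] -/
theorem ofReal_indicator_damped (σ u : ℝ) :
    ((((Set.Ici (0 : ℝ)).indicator (fun _ ↦ (1 : ℝ)) u * Real.exp (-(σ * u)) : ℝ)) : ℂ) =
      expMode 0 σ u := by
  rcases lt_or_ge u 0 with hu | hu
  · rw [expMode_of_neg hu, Set.indicator_of_notMem (by simpa using hu)]; simp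
  · rw [expMode_of_nonneg hu, Set.indicator_of_mem (Set.mem_Ici.2 hu), one_mul, Complex.ofReal_exp]
    congr 1; push_cast; ring

/-- `q(u) e^{-σu}` is integrable for `σ > 0`. [folklore] -/
theorem integrable_negPart_damped {σ : ℝ} (hσ : 0 < σ) :
    Integrable (fun u ↦ h.negPart u * Real.exp (-(σ * u))) := by
  have : (fun u ↦ h.negPart u * Real.exp (-(σ * u))) = fun u ↦
      max A 0 * ((Set.Ici (0 : ℝ)).indicator (fun _ ↦ (1 : ℝ)) u * Real.exp (-(σ * u))) -
        f u * Real.exp (-(σ * u)) := by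
    ext u; rw [negPart_apply]; ring
  rw [this]
  exact ((integrable_indicator_damped hσ).const_mul _).sub (h.f_int σ hσ)

/-- The limit value `L(y) = max(A,0) Φ[E_{0,0}](y) - (2π)⁻¹ ∫ k e^{ity} R(it) dt - Σ a_i Φ[E_{γ_i,0}](y)`.
[folklore] -/
def limitValue (_h : SmoothingData P γ a f K k R A σ₀ T') (y : ℝ) : ℂ :=
  (max A 0 : ℝ) * (∫ u, (K (y - u) : ℂ) * expMode 0 0 u) -
    (((2 * π)⁻¹ : ℝ) : ℂ) * (∫ t, k t * cexp (((t * y : ℝ) : ℂ) * I) * R (t * I)) -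
    ∑ i ∈ P, a i * ∫ u, (K (y - u) : ℂ) * expMode (γ i) 0 u

/-- **The damped identity**: for `0 < σ ≤ σ₀`,
`∫ K(y-u) q(u) e^{-σu} du = max(A,0) Φ[E_{0,σ}](y) - (2π)⁻¹∫ k e^{ity} R(σ+it) - Σ a_i Φ[E_{γ_i,σ}](y)`.
[cite: BatemanDiamond2004, Theorem 11.12 (proof, (11.10))] -/
theorem integral_negPart_damped_eq {σ : ℝ} (hσ : 0 < σ) (hσ' : σ ≤ σ₀) (y : ℝ) :
    ((∫ u, K (y - u) * (h.negPart u * Real.exp (-(σ * u))) : ℝ) : ℂ) =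
      (max A 0 : ℝ) * (∫ u, (K (y - u) : ℂ) * expMode 0 σ u) -
        (((2 * π)⁻¹ : ℝ) : ℂ) * (∫ t, k t * cexp (((t * y : ℝ) : ℂ) * I) * R (σ + t * I)) -
        ∑ i ∈ P, a i * ∫ u, (K (y - u) : ℂ) * expMode (γ i) σ u := by
  rw [← h.smooth_diff_eq hσ hσ' y, ← integral_complex_ofReal]
  have hpt : ∀ u, (((K (y - u) * (h.negPart u * Real.exp (-(σ * u))) : ℝ)) : ℂ) =
      (max A 0 : ℝ) * ((K (y - u) : ℂ) * expMode 0 σ u) -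
        ((K (y - u) : ℂ) * h.diff σ u + ∑ i ∈ P, a i * ((K (y - u) : ℂ) * expMode (γ i) σ u)) := by
    intro u
    rw [diff_apply, negPart_apply, ← ofReal_indicator_damped σ u]
    have : ∑ i ∈ P, a i * ((K (y - u) : ℂ) * expMode (γ i) σ u) =
        (K (y - u) : ℂ) * ∑ i ∈ P, a i * expMode (γ i) σ u := by
      rw [Finset.mul_sum]; refine Finset.sum_congr rfl fun i _ ↦ by ring
    rw [this]
    push_cast
    ring
  simp_rw [hpt]
  have hi1 : Integrable fun u ↦ (K (y - u) : ℂ) * expMode 0 σ u :=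
    h.integrable_kernel_mul (integrable_expMode 0 hσ) y
  have hi2 : Integrable fun u ↦ (K (y - u) : ℂ) * h.diff σ u :=
    h.integrable_kernel_mul (h.integrable_diff hσ) y
  have hi3 : ∀ i ∈ P, Integrable fun u ↦ a i * ((K (y - u) : ℂ) * expMode (γ i) σ u) :=
    fun i _ ↦ (h.integrable_kernel_mul (integrable_expMode _ hσ) y).const_mul _
  have hi23 : Integrable (fun u ↦ (K (y - u) : ℂ) * h.diff σ u +
      ∑ i ∈ P, a i * ((K (y - u) : ℂ) * expMode (γ i) σ u)) := hi2.add (integrable_finsetSum _ hi3)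
  rw [integral_sub (hi1.const_mul _) hi23, integral_add hi2 (integrable_finsetSum _ hi3),
    integral_finsetSum _ hi3, integral_const_mul]
  have h4 : ∑ i ∈ P, ∫ u, a i * ((K (y - u) : ℂ) * expMode (γ i) σ u) =
      ∑ i ∈ P, a i * ∫ u, (K (y - u) : ℂ) * expMode (γ i) σ u :=
    Finset.sum_congr rfl fun i _ ↦ integral_const_mul (a i) _
  rw [h4]
  ring

/-- **The limit `σ → 0⁺`** of `∫ K(y-u) q(u) e^{-σu} du` exists and equals `L(y)`.
[cite: BatemanDiamond2004, Theorem 11.12 (proof, after (11.10))] -/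
theorem tendsto_integral_negPart_damped (y : ℝ) :
    Tendsto (fun σ : ℝ ↦ (((∫ u, K (y - u) * (h.negPart u * Real.exp (-(σ * u))) : ℝ)) : ℂ))
      (𝓝[>] 0) (𝓝 (h.limitValue y)) := by
  have hev : ∀ᶠ σ : ℝ in 𝓝[>] 0, 0 < σ ∧ σ ≤ σ₀ := by
    filter_upwards [Ioo_mem_nhdsGT h.σ₀_pos] with σ hσ using ⟨hσ.1, hσ.2.le⟩
  refine Tendsto.congr' (EventuallyEq.symm (hev.mono fun σ hσ ↦ h.integral_negPart_damped_eq hσ.1 hσ.2 y)) ?_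
  unfold limitValue
  refine ((tendsto_const_nhds.mul (tendsto_smooth_expMode h.K_cont h.K_int 0 y)).sub
    (tendsto_const_nhds.mul (h.tendsto_integral_R y))).sub ?_
  exact tendsto_finsetSum _ fun i _ ↦
    tendsto_const_nhds.mul (tendsto_smooth_expMode h.K_cont h.K_int (γ i) y)

/-- **Monotone convergence step**: `K(y-·) q` is integrable and
`∫ K(y-u) q(u) du = Re L(y)` (the damped integrals increase to it as `σ ↓ 0`).
[cite: BatemanDiamond2004, Theorem 11.12 (proof, "Arguing as we did to take the limit inside the integral")] -/
theorem integrable_kernel_negPart (y : ℝ) :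
    Integrable (fun u ↦ K (y - u) * h.negPart u) ∧
      ∫ u, K (y - u) * h.negPart u = (h.limitValue y).re := by
  -- the sequence `σ_n = 1/(n+1)`
  set σn : ℕ → ℝ := fun n ↦ 1 / ((n : ℝ) + 1) with hσn
  have hσn_pos : ∀ n, 0 < σn n := fun n ↦ by positivity
  have hσn0 : Tendsto σn atTop (𝓝 0) := tendsto_one_div_add_atTop_nhds_zero_nat
  have hσn0' : Tendsto σn atTop (𝓝[>] 0) :=
    tendsto_nhdsWithin_iff.2 ⟨hσn0, Eventually.of_forall hσn_pos⟩
  have hσn_anti : Antitone σn := fun m n hmn ↦ by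
    apply one_div_le_one_div_of_le (by positivity)
    have : (m : ℝ) ≤ n := by exact_mod_cast hmn
    linarith
  set g : ℝ → ℝ := fun u ↦ K (y - u) * h.negPart u with hg
  set gn : ℕ → ℝ → ℝ := fun n u ↦ K (y - u) * (h.negPart u * Real.exp (-(σn n * u))) with hgn
  have hgn_int : ∀ n, Integrable (gn n) := fun n ↦
    h.integrable_kernel_mul_real (h.integrable_negPart_damped (hσn_pos n)) y
  have hgn_nonneg : ∀ n u, 0 ≤ gn n u := fun n u ↦
    mul_nonneg (h.K_nonneg _) (mul_nonneg (h.negPart_nonneg u) (Real.exp_pos _).le)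
  have hg_nonneg : ∀ u, 0 ≤ g u := fun u ↦ mul_nonneg (h.K_nonneg _) (h.negPart_nonneg u)
  have hgn_mono : ∀ u, Monotone fun n ↦ gn n u := by
    intro u m n hmn
    simp only [hgn]
    rcases lt_or_ge u 0 with hu | hu
    · rw [h.negPart_of_neg hu]; simp
    · refine mul_le_mul_of_nonneg_left ?_ (h.K_nonneg _)
      refine mul_le_mul_of_nonneg_left ?_ (h.negPart_nonneg u)
      refine Real.exp_le_exp.2 ?_
      have := hσn_anti hmn
      nlinarith
  have hgn_lim : ∀ u, Tendsto (fun n ↦ gn n u) atTop (𝓝 (g u)) := by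
    intro u
    have h1 : Tendsto (fun n ↦ Real.exp (-(σn n * u))) atTop (𝓝 (Real.exp (-(0 * u)))) :=
      (Real.continuous_exp.tendsto _).comp ((hσn0.mul_const u).neg)
    rw [zero_mul, neg_zero, Real.exp_zero] at h1
    have := (tendsto_const_nhds (x := h.negPart u)).mul h1
    rw [mul_one] at this
    exact (tendsto_const_nhds (x := K (y - u))).mul this
  -- the integrals converge to `Re L(y)`
  have hint_lim : Tendsto (fun n ↦ ∫ u, gn n u) atTop (𝓝 (h.limitValue y).re) := by
    have h1 := (h.tendsto_integral_negPart_damped y).comp hσn0'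
    have h2 := (Complex.continuous_re.tendsto _).comp h1
    refine h2.congr fun n ↦ ?_
    simp only [Function.comp_apply, Complex.ofReal_re, hgn]
  -- monotone convergence for the Lebesgue integral
  have hlin := lintegral_tendsto_of_tendsto_of_monotone (μ := volume)
    (F := fun u ↦ ENNReal.ofReal (g u)) (f := fun n u ↦ ENNReal.ofReal (gn n u))
    (fun n ↦ (hgn_int n).aemeasurable.ennreal_ofReal)
    (ae_of_all _ fun u m n hmn ↦ ENNReal.ofReal_le_ofReal (hgn_mono u hmn))
    (ae_of_all _ fun u ↦ (ENNReal.continuous_ofReal.tendsto _).comp (hgn_lim u))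
  have heqn : ∀ n, ∫⁻ u, ENNReal.ofReal (gn n u) = ENNReal.ofReal (∫ u, gn n u) := fun n ↦
    (ofReal_integral_eq_lintegral_ofReal (hgn_int n) (ae_of_all _ (hgn_nonneg n))).symm
  simp_rw [heqn] at hlin
  have hlin' : Tendsto (fun n ↦ ENNReal.ofReal (∫ u, gn n u)) atTop
      (𝓝 (ENNReal.ofReal (h.limitValue y).re)) :=
    (ENNReal.continuous_ofReal.tendsto _).comp hint_lim
  have hlinteq : ∫⁻ u, ENNReal.ofReal (g u) = ENNReal.ofReal (h.limitValue y).re :=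
    tendsto_nhds_unique hlin hlin'
  have hg_meas : AEStronglyMeasurable g :=
    ((h.K_cont.comp (continuous_sub_left y)).measurable.mul h.measurable_negPart).aestronglyMeasurable
  have hg_int : Integrable g :=
    ⟨hg_meas, (hasFiniteIntegral_iff_ofReal (ae_of_all _ hg_nonneg)).2
      (by rw [hlinteq]; exact ENNReal.ofReal_lt_top)⟩
  refine ⟨hg_int, ?_⟩
  have h1 := integral_tendsto_of_tendsto_of_monotone hgn_int hg_int (ae_of_all _ hgn_mono)
    (ae_of_all _ hgn_lim)
  exact tendsto_nhds_unique h1 hint_lim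

/-- **The smoothed explicit formula** (Bateman–Diamond (11.7), general band-limited kernel, in
logarithmic variables): under `SmoothingData`, `u ↦ K(y-u) f(u)` is integrable for every `y` and
`∫ K(y-u) f(u) du = Re Σ_i a_i k(γ_i) e^{iγ_i y} + o(1)` as `y → ∞`.
[cite: BatemanDiamond2004, Theorem 11.12, (11.7)] -/
theorem smoothed_explicit_formula :
    (∀ y, Integrable (fun u ↦ K (y - u) * f u)) ∧
    Tendsto (fun y ↦ (∫ u, K (y - u) * f u) -
      (∑ i ∈ P, a i * k (γ i) * cexp (((γ i * y : ℝ) : ℂ) * I)).re) atTop (𝓝 0) := by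
  -- `f = max(A,0) 1_{[0,∞)} - q`
  set χ : ℝ → ℝ := (Set.Ici (0 : ℝ)).indicator fun _ ↦ (1 : ℝ) with hχ
  have hf_eq : ∀ u, f u = max A 0 * χ u - h.negPart u := fun u ↦ by rw [negPart_apply]; ring
  have hχK : ∀ y, Integrable (fun u ↦ K (y - u) * χ u) := fun y ↦
    (h.K_int.comp_sub_left y).mul_bdd (measurable_const.indicator measurableSet_Ici).aestronglyMeasurable
      (c := 1) (ae_of_all _ fun u ↦ by
        simp only [hχ, Set.indicator_apply]; split_ifs <;> simp)
  have hχE : ∀ y, (((∫ u, K (y - u) * χ u) : ℝ) : ℂ) = ∫ u, (K (y - u) : ℂ) * expMode 0 0 u := by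
    intro y
    rw [← integral_complex_ofReal]
    refine integral_congr_ae (ae_of_all _ fun u ↦ ?_)
    show (((K (y - u) * χ u : ℝ)) : ℂ) = (K (y - u) : ℂ) * expMode 0 0 u
    rw [← ofReal_indicator_damped 0 u]
    push_cast
    simp [hχ]
  have hint : ∀ y, Integrable (fun u ↦ K (y - u) * f u) := by
    intro y
    have : (fun u ↦ K (y - u) * f u) = fun u ↦ max A 0 * (K (y - u) * χ u) - K (y - u) * h.negPart u := by
      ext u; rw [hf_eq]; ring
    rw [this]
    exact ((hχK y).const_mul _).sub (h.integrable_kernel_negPart y).1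
  refine ⟨hint, ?_⟩
  -- the value of `∫ K(y-u) f(u) du` as a real part
  have hval : ∀ y, (∫ u, K (y - u) * f u) =
      ((((2 * π)⁻¹ : ℝ) : ℂ) * (∫ t, k t * cexp (((t * y : ℝ) : ℂ) * I) * R (t * I)) +
        ∑ i ∈ P, a i * ∫ u, (K (y - u) : ℂ) * expMode (γ i) 0 u).re := by
    intro y
    have h1 : (∫ u, K (y - u) * f u) =
        max A 0 * (∫ u, K (y - u) * χ u) - ∫ u, K (y - u) * h.negPart u := by
      have : (fun u ↦ K (y - u) * f u) =
          fun u ↦ max A 0 * (K (y - u) * χ u) - K (y - u) * h.negPart u := by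
        ext u; rw [hf_eq]; ring
      rw [this, integral_sub ((hχK y).const_mul _) (h.integrable_kernel_negPart y).1,
        integral_const_mul]
    rw [h1, (h.integrable_kernel_negPart y).2]
    have h2 : max A 0 * (∫ u, K (y - u) * χ u) =
        ((max A 0 : ℝ) * ∫ u, (K (y - u) : ℂ) * expMode 0 0 u).re := by
      rw [← hχE y, ← Complex.ofReal_mul, Complex.ofReal_re]
    rw [h2, ← Complex.sub_re]
    congr 1
    unfold limitValue
    ring
  simp_rw [hval]
  have hre : ∀ y, ((((2 * π)⁻¹ : ℝ) : ℂ) * (∫ t, k t * cexp (((t * y : ℝ) : ℂ) * I) * R (t * I)) +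
        ∑ i ∈ P, a i * ∫ u, (K (y - u) : ℂ) * expMode (γ i) 0 u).re -
      (∑ i ∈ P, a i * k (γ i) * cexp (((γ i * y : ℝ) : ℂ) * I)).re =
      ((((2 * π)⁻¹ : ℝ) : ℂ) * (∫ t, k t * cexp (((t * y : ℝ) : ℂ) * I) * R (t * I)) +
        ∑ i ∈ P, a i * ((∫ u, (K (y - u) : ℂ) * expMode (γ i) 0 u) -
          k (γ i) * cexp (((γ i * y : ℝ) : ℂ) * I))).re := by
    intro y
    rw [← Complex.sub_re]
    congr 1
    simp only [mul_sub, Finset.sum_sub_distrib, mul_assoc]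
    ring
  simp_rw [hre]
  have hW : Tendsto (fun y : ℝ ↦ (((2 * π)⁻¹ : ℝ) : ℂ) *
        (∫ t, k t * cexp (((t * y : ℝ) : ℂ) * I) * R (t * I)) +
      ∑ i ∈ P, a i * ((∫ u, (K (y - u) : ℂ) * expMode (γ i) 0 u) -
        k (γ i) * cexp (((γ i * y : ℝ) : ℂ) * I))) atTop
      (𝓝 ((((2 * π)⁻¹ : ℝ) : ℂ) * 0 + ∑ i ∈ P, a i * 0)) :=
    (tendsto_const_nhds.mul (tendsto_integral_R_atTop k R)).add
      (tendsto_finsetSum _ fun i _ ↦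
        tendsto_const_nhds.mul (tendsto_smooth_expMode_sub h.K_int h.k_eq (γ i)))
  have h2 := (Complex.continuous_re.tendsto _).comp hW
  have h3 : ((((2 * π)⁻¹ : ℝ) : ℂ) * 0 + ∑ i ∈ P, a i * 0).re = 0 := by simp
  rw [h3] at h2
  exact h2

end SmoothingData
/-! ### Ingham's theorem, abstract form: one-sided bounds force oscillation about `Re S(y₀)` -/

/-- **Ingham's oscillation theorem, abstract form, upper half** (the mechanism of
Bateman–Diamond Thm. 11.12, (11.8), by contradiction): let `f` be real, measurable, vanishing
on `(-∞,0)` and locally bounded; `K ≥ 0` continuous integrable of mass `1` with transform `k`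
vanishing for `|t| ≥ T'`; and suppose that *whenever `f` is bounded above*, its damped versions
are integrable and its Laplace transform on `0 < σ ≤ σ₀, |t| ≤ T'` is `Σ a_i/(s - iγ_i)` plus a
function continuous on the closed rectangle `[0,σ₀] × [-T',T']`. Then for every `y₀` and
`ε > 0`, `f(y) > Re S(y₀) - ε` for arbitrarily large `y`, where `S(y) = Σ a_i k(γ_i) e^{iγ_i y}`.
[cite: BatemanDiamond2004, Theorem 11.12, (11.8)] -/
theorem frequently_gt_of_laplace {ι : Type*} (P : Finset ι) (γ : ι → ℝ) (a : ι → ℂ)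
    {f K : ℝ → ℝ} {k : ℝ → ℂ} {σ₀ T' : ℝ}
    (hfm : Measurable f) (hf0 : ∀ u, u < 0 → f u = 0) (hfloc : ∀ b, ∃ B, ∀ u, u ≤ b → |f u| ≤ B)
    (hKc : Continuous K) (hKnn : ∀ v, 0 ≤ K v) (hKi : Integrable K) (hK1 : ∫ v, K v = 1)
    (hk : ∀ t, k t = ∫ y, (K y : ℂ) * cexp (-((t * y : ℝ) : ℂ) * I))
    (hks : ∀ t, T' ≤ |t| → k t = 0) (hσ₀ : 0 < σ₀)
    (hL : ∀ A : ℝ, (∀ u, f u ≤ A) →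
      (∀ σ, 0 < σ → Integrable (fun u ↦ f u * Real.exp (-(σ * u)))) ∧
      ∃ R : ℂ → ℂ, ContinuousOn R (Set.Icc 0 σ₀ ×ℂ Set.Icc (-T') T') ∧
        ∀ σ t : ℝ, 0 < σ → σ ≤ σ₀ → |t| ≤ T' →
          ∫ u, (f u : ℂ) * cexp (-(((σ : ℂ) + t * I) * u)) =
            ∑ i ∈ P, a i / ((σ : ℂ) + t * I - γ i * I) + R (σ + t * I))
    (y₀ : ℝ) {ε : ℝ} (hε : 0 < ε) :
    ∃ᶠ y in atTop, (∑ i ∈ P, a i * k (γ i) * cexp (((γ i * y₀ : ℝ) : ℂ) * I)).re - ε < f y := by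
  set S : ℝ → ℂ := fun y ↦ ∑ i ∈ P, a i * k (γ i) * cexp (((γ i * y : ℝ) : ℂ) * I) with hS
  show ∃ᶠ y in atTop, (S y₀).re - ε < f y
  by_contra hcon
  rw [not_frequently] at hcon
  obtain ⟨y₁, hy₁⟩ := eventually_atTop.1 hcon
  -- a global upper bound
  obtain ⟨B, hB⟩ := hfloc y₁
  set A : ℝ := max ((S y₀).re - ε) B with hA
  have hfa : ∀ u, y₁ ≤ u → f u ≤ (S y₀).re - ε := fun u hu ↦ not_lt.1 (hy₁ u hu)
  have hfA : ∀ u, f u ≤ A := by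
    intro u
    rcases le_or_gt y₁ u with hu | hu
    · exact (hfa u hu).trans (le_max_left _ _)
    · exact ((le_abs_self _).trans (hB u hu.le)).trans (le_max_right _ _)
  obtain ⟨hint, R, hRc, hRe⟩ := hL A hfA
  have hD : SmoothingData P γ a f K k R A σ₀ T' :=
    ⟨hfm, hf0, hfA, hint, hKc, hKnn, hKi, hk, hks, hσ₀, hRc, hRe⟩
  obtain ⟨hIf, hT⟩ := hD.smoothed_explicit_formula
  -- averaging: eventually `∫ K(y-u) f(u) du ≤ Re S(y₀) - ε + ε/3`
  have hε3 : 0 < ε / 3 := by positivity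
  have hav := eventually_average_le hKnn hKi hK1 hfa (fun u hu ↦ hB u hu.le) hIf hε3
  -- hence eventually `Re S(y) ≤ Re S(y₀) - ε/3`
  have hev : ∀ᶠ y in atTop, (S y).re ≤ (S y₀).re - ε / 3 := by
    have h2 := (Metric.tendsto_nhds.1 hT) (ε / 3) hε3
    filter_upwards [hav, h2] with y h1 h3
    rw [Real.dist_eq, sub_zero] at h3
    have := (abs_lt.1 h3).1
    linarith
  -- but `S` returns near `S(y₀)`
  have hfr : ∃ᶠ y in atTop, ‖S y - S y₀‖ < ε / 3 := by
    have := trigSum_frequently_near P γ (fun i ↦ a i * k (γ i)) y₀ hε3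
    simpa only [hS] using this
  obtain ⟨y, hy1, hy2⟩ := (hfr.and_eventually hev).exists
  have hre : |(S y - S y₀).re| ≤ ‖S y - S y₀‖ := Complex.abs_re_le_norm _
  rw [Complex.sub_re] at hre
  linarith [(abs_lt.1 (lt_of_le_of_lt hre hy1)).1]

/-- **Ingham's oscillation theorem, abstract form** (Bateman–Diamond Thm. 11.12, (11.8):
`liminf F ≤ F_T*(u) ≤ limsup F` for every `u`, for a general admissible kernel): with `f`, `K`,
`k` as above, if *each* one-sided bound on `f` yields the Laplace representation (integrable
damping, polar parts `a_i/(s-iγ_i)`, regular part continuous on the closed rectangle), then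
for every `y₀` and `ε > 0`: `f(y) > Re S(y₀) - ε` and `f(y) < Re S(y₀) + ε` for arbitrarily
large `y`, `S(y) = Σ a_i k(γ_i) e^{iγ_i y}`. If neither one-sided bound holds the conclusion is
trivial, as remarked by Bateman–Diamond (Remarks 11.13).
[cite: BatemanDiamond2004, Theorem 11.12, (11.8) and Remarks 11.13] -/
theorem frequently_gt_and_lt_of_laplace {ι : Type*} (P : Finset ι) (γ : ι → ℝ) (a : ι → ℂ)
    {f K : ℝ → ℝ} {k : ℝ → ℂ} {σ₀ T' : ℝ}
    (hfm : Measurable f) (hf0 : ∀ u, u < 0 → f u = 0) (hfloc : ∀ b, ∃ B, ∀ u, u ≤ b → |f u| ≤ B)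
    (hKc : Continuous K) (hKnn : ∀ v, 0 ≤ K v) (hKi : Integrable K) (hK1 : ∫ v, K v = 1)
    (hk : ∀ t, k t = ∫ y, (K y : ℂ) * cexp (-((t * y : ℝ) : ℂ) * I))
    (hks : ∀ t, T' ≤ |t| → k t = 0) (hσ₀ : 0 < σ₀)
    (hL : ∀ A : ℝ, ((∀ u, f u ≤ A) ∨ (∀ u, -A ≤ f u)) →
      (∀ σ, 0 < σ → Integrable (fun u ↦ f u * Real.exp (-(σ * u)))) ∧
      ∃ R : ℂ → ℂ, ContinuousOn R (Set.Icc 0 σ₀ ×ℂ Set.Icc (-T') T') ∧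
        ∀ σ t : ℝ, 0 < σ → σ ≤ σ₀ → |t| ≤ T' →
          ∫ u, (f u : ℂ) * cexp (-(((σ : ℂ) + t * I) * u)) =
            ∑ i ∈ P, a i / ((σ : ℂ) + t * I - γ i * I) + R (σ + t * I))
    (y₀ : ℝ) {ε : ℝ} (hε : 0 < ε) :
    (∃ᶠ y in atTop, (∑ i ∈ P, a i * k (γ i) * cexp (((γ i * y₀ : ℝ) : ℂ) * I)).re - ε < f y) ∧
    (∃ᶠ y in atTop, f y < (∑ i ∈ P, a i * k (γ i) * cexp (((γ i * y₀ : ℝ) : ℂ) * I)).re + ε) := by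
  constructor
  · exact frequently_gt_of_laplace P γ a hfm hf0 hfloc hKc hKnn hKi hK1 hk hks hσ₀
      (fun A hA ↦ hL A (Or.inl hA)) y₀ hε
  · -- apply the upper half to `-f`, with coefficients `-a_i` and regular part `-R`
    have hL' : ∀ A : ℝ, (∀ u, -f u ≤ A) →
        (∀ σ, 0 < σ → Integrable (fun u ↦ -f u * Real.exp (-(σ * u)))) ∧
        ∃ R : ℂ → ℂ, ContinuousOn R (Set.Icc 0 σ₀ ×ℂ Set.Icc (-T') T') ∧
          ∀ σ t : ℝ, 0 < σ → σ ≤ σ₀ → |t| ≤ T' →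
            ∫ u, ((-f u : ℝ) : ℂ) * cexp (-(((σ : ℂ) + t * I) * u)) =
              ∑ i ∈ P, (-a i) / ((σ : ℂ) + t * I - γ i * I) + R (σ + t * I) := by
      intro A hA
      obtain ⟨hint, R, hRc, hRe⟩ := hL A (Or.inr fun u ↦ by linarith [hA u])
      refine ⟨fun σ hσ ↦ ?_, fun s ↦ -R s, hRc.neg, fun σ t hσ hσ' ht ↦ ?_⟩
      · have := (hint σ hσ).neg
        refine this.congr (ae_of_all _ fun u ↦ ?_)
        simp only [Pi.neg_apply, neg_mul]
      · have h1 : ∫ u, ((-f u : ℝ) : ℂ) * cexp (-(((σ : ℂ) + t * I) * u)) =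
            -∫ u, (f u : ℂ) * cexp (-(((σ : ℂ) + t * I) * u)) := by
          rw [← integral_neg]
          refine integral_congr_ae (ae_of_all _ fun u ↦ ?_)
          push_cast; ring
        rw [h1, hRe σ t hσ hσ' ht, neg_add, ← Finset.sum_neg_distrib]
        congr 1
        exact Finset.sum_congr rfl fun i _ ↦ by rw [neg_div]
    have h := frequently_gt_of_laplace P γ (fun i ↦ -a i) (f := fun u ↦ -f u) hfm.neg
      (fun u hu ↦ by simp [hf0 u hu]) (fun b ↦ ?_) hKc hKnn hKi hK1 hk hks hσ₀ hL' y₀ hε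
    · refine h.mono fun y hy ↦ ?_
      have : (∑ i ∈ P, -a i * k (γ i) * cexp (((γ i * y₀ : ℝ) : ℂ) * I)).re =
          -(∑ i ∈ P, a i * k (γ i) * cexp (((γ i * y₀ : ℝ) : ℂ) * I)).re := by
        rw [← Complex.neg_re, ← Finset.sum_neg_distrib]
        congr 1
        exact Finset.sum_congr rfl fun i _ ↦ by ring
      rw [this] at hy
      linarith
    · obtain ⟨B, hB⟩ := hfloc b
      exact ⟨B, fun u hu ↦ by rw [abs_neg]; exact hB u hu⟩

end InghamSmoothing
end Literature.NumberTheory.LFunctions
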